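import Summits.BirchSwinnertonDyer.Rank1Residual.Additive.X4RankOneKimCorner
import Summits.BirchSwinnertonDyer.Rank1Residual.Additive.GordThreeCycRankOne
import Summits.BirchSwinnertonDyer.Rank1Residual.AdditivePotMult.PotMultCycLowerBoundClass
import HarnessLib

/-!
# X4 ∧ `r_an = 1`, `p = 3`: the rank-one corner ON THE CENSUS ROWS of O7 ∩ X4@3 and its COMPOSITION with
# team n1011's LOWER@3 strand (p01, `CycLowerBoundAt W 3 Dh`) — `BSD(E,3)` on the SHA3 rows modulo
# {`∂`-clause@3, Conj. 1.10 `≥`, `CycLowerBoundAt`@3} + ONE certificate (cell `b2b-bsdres`, team n1011,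
# sub-target T-a2r1c — FILE 3b, sibling of `Additive/X4RankOneKimCorner.lean`)

HONEST FRAMING (cell `b2b-bsdres`, run/shared/lean/b2b/bsd-rank1-residual/, verbatim in every
file): the goal of the cell is to DELETE the COMBINATION-SHAPED residual classes of the
Birch–Swinnerton-Dyer formula for ALL analytic-rank `≤ 1` elliptic curves over `ℚ` — "full BSD
formula for every rank `≤ 1` curve in class `C`" assembled STRICTLY from published theorems — so
that the rank-`≤ 1` remainder becomes exactly the CONSTRUCTION-SHAPED classes, which are TYPED
(missing-input `Prop`s), NOT attempted. This is not "finishing BSD". Team n1011: prove what is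
provable now; shrink each hard class to its core with data; no claim beyond stated classes;
research routes; census output = EVIDENCE / conjecture items, never a Literature fact; RESIDUAL-MAP
marks change only by signed lines. X4 stays CONSTRUCTION-SHAPED; §I O7 / N10 / N11 stay as marked;
nothing here is booked. Theorems only (NO definition, NO Literature fact, NO `_holds`); every published
input and every conjecture is an explicit hypothesis; `#print axioms` standard.

COVERAGE (stated first, referee 1 proviso): per pair, `p = 3`, `W/ℚ` globally minimal, `ClassX4 W 3`
(additive at `3`, `E[3]` irreducible), `ρ̄_{E,3}` onto, a tower certificate (`j`-witness
`∃ q ≠ 3, ord_q j < 0, 3 ∤ ord_q j` or surj(9)), analytic rank `1`; §3 additionally the (G-ord)@3 cell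
(`ClassX4Gord W 3`, `E` WITHOUT CM, reduction NON-anomalous over the (G)-field) or the (M) cell
(`ClassX4M W 3`). HYPOTHESES of every theorem, all explicit: `X4SharpThreeKimRankOnePartial` (OUR
conjecture at `3`; [K25] Thm. 1.1 announced is the reason, not a source), `X4.KimTamagawaDefectGeAt W 3 D.f`
(Kim's Conj. 1.10, `≥` half), the datum `D` with `3 ∤ c_D` and the period transfer (or optimality), the
certificate (ONE Kurihara number `≢ 0 (mod 3^{ord₃∏c + s + 1})` at a cyclic `ℓ ∈ 𝒫_{ord₃∏c + s + 1}`,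
`s ≤ ord₃ #Ш_an`), and in §3 `Delbourgo2002.mainTheorem_three` / `mainTheorem_potMult` (PUBLISHED) with
the typed Eisenstein half `CycLowerBoundAt W 3 Dh` + Schneider rider for every (B)-datum. The O7-ss rows
(potentially supersingular `3`: 25 of the 65 SHA3 rows, cells t′3 16 · w 9) have no LOWER input in print
or typed (RESIDUAL-MAP §I O7-ss: nothing formulated) and stay at §2's `iff`; the EXOTIC row and the
NONSURJ rows are outside.

## What this file proves (numbers: p17's two-source anatomy of record, R3-22 — O7 ∩ X4@3 ∧ `r_an = 1` =
10 692 S-b pairs = O7-ord 3 585 ((M) 3 009 · Gord3 576) + O7-ss 7 107 (t′3 1 759 · w 5 348); SHA3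
(`3 ∣ #Ш_an`, all with `ord₃ #Ш_an = 2`) = 65 = O7-ord 40 ((M) 28 · Gord3 12) + O7-ss 25)

* §2 `X4RankOne.missingPPartAt_three_iff_lower_of_partial_of_tamagawaDefectGe_of_cert` — on a SHA3 row
  the missing `3`-part output IS its LOWER half; `X4RankOne.bsdp_three_iff_lower_…` (+ `_of_optimal`,
  period binder discharged by `X4.periodTransfer_of_optimal`).
* §3 `ClassX4Gord.bsdp_three_rankOne_of_partial_of_cert_of_cycLowerBound` (via p01's p251445
  `ClassX4Gord.missingLowerBoundAt_three_rankLeOne_of_cycLowerBound`) and, in the namespace of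
  `ClassX4M`, `ClassX4M.bsdp_three_rankOne_of_partial_of_cert_of_cycLowerBound` (via p01's
  `ClassX4M.missingLowerBoundAt_rankLeOne_of_cycLowerBound`): `BSD(E,3)` on a SHA3 row of O7-ord ∩ X4
  from the three typed/conjectural inputs + ONE certificate at level `ord₃ ∏c + s + 1`, `s ≤ ord₃ #Ш_an`
  (so `s = ord₃ #Ш_an` is the level the I-12@3 rank-one request should probe on these rows).

With FILES 1–2 (U 1 575 / L2 561 / TAM2+ 7 903: one certificate at level `ord₃∏c + 1`, both halves of
O7 since Kim's clause has no reduction hypothesis) this gives EVERY surjective, towered row of O7 ∩ X4@3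
a kernel shape: 10 039 rows one-certificate-shaped modulo two conjectures; the 40 O7-ord SHA3 rows
one-certificate-shaped (level `ord₃∏c + 3`) modulo two conjectures + the typed LOWER input; the 25 O7-ss
SHA3 rows at the `iff` (LOWER input unformulated); NONSURJ 587 = O8 strand; EXOTIC 1. Nothing is
thereby closed or booked.

References: C.-H. Kim, Amer. J. Math. 148 (2026) = arXiv:2203.12159v4 [Kim2022StructureSelmer] Thm. 1.9
(6), §1.5.1, Conj. 1.10 (PDF p. 8); D. Delbourgo, J. Number Theory 95 (2002) [Delbourgo2002] Thm. (A),
(B) (p. 40), Hypothesis (p. 39); R. L. Miller, LMS J. Comput. Math. 14 (2011) [Miller2011LMS] Def. 1.1;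
J.-P. Serre [SerreAbelianLadic1968] IV-23; J. E. Cremona [CremonaAlgorithms1997] §2.8; cell files
cells/n1011/OWNERS.md (T-a2r1c, T-O7), HOME/INBOX.md 2026-08-21 06:33Z (p17).
-/

noncomputable section

open scoped Classical MatrixGroups ModularForm NumberField

open CongruenceSubgroup WeierstrassCurve Literature.NumberTheory.EllipticCurves
  Literature.NumberTheory.EllipticCurves.ModularForms
  Literature.NumberTheory.EllipticCurves.Rank1Residual
  Literature.NumberTheory.EllipticCurves.Rank1Residual.Typed
  Literature.NumberTheory.EllipticCurves.Delbourgo2002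

namespace Summit.BirchSwinnertonDyer.Rank1Residual.Additive

/-! ## §2 The `p = 3` census shapes on O7 ∩ X4@3 (modulo the two conjectures) -/

section Three

variable (W : WeierstrassCurve ℚ) [W.IsElliptic] [W.IsGloballyMinimal]

/-- **O7 ∩ X4@3, SHA row: the rank-one corner at `3`.** On `ClassX4 W 3` ∧ `r_an = 1` with surj(3), a
tower certificate (`j`-witness or surj(9)), `Ш` finite and `L(E,1) = 0` (both from `hGZK`/`hmod`), a datum
`D` with `3 ∤ c_D` and the period transfer, `#Ш_an = q`, ONE `δ̃_ℓ ≢ 0 (mod 3^{ord₃∏c + s + 1})` at a cyclic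
`ℓ ∈ 𝒫_{ord₃∏c + s + 1}(E,3)` with `s ≤ ord₃ q`: `MissingPPartAt W 3 ↔ MissingLowerBoundAt W 3` — MODULO
`X4SharpThreeKimRankOnePartial` (`h3`) and `X4.KimTamagawaDefectGeAt W 3 D.f` (`hGe`). Per pair; NOT a
class theorem; nothing booked. [cite: Kim2022StructureSelmer, Thm. 1.9 (6), Conj. 1.10 (PDF p. 8)]
[cite: SerreAbelianLadic1968, Ch. IV §3.4, Lemma 3 (IV-23)] [cite: Miller2011LMS, Def. 1.1] -/
theorem X4RankOne.missingPPartAt_three_iff_lower_of_partial_of_tamagawaDefectGe_of_cert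
    (h3 : X4SharpThreeKimRankOnePartial) (hGZK : rank_eq_analyticRank_of_analyticRank_le_one)
    (hmod : hasEntireLFunction_rat) (hX : ClassX4 W 3) (hsurj : Surj W 3)
    (hcert : (∃ q : ℕ, q.Prime ∧ q ≠ 3 ∧ padicValRat q W.j < 0 ∧ ¬ (3 : ℤ) ∣ padicValRat q W.j) ∨
      W.HasSurjectiveModNGaloisRep 9)
    (hr : W.analyticRank = 1) {q : ℚ} (hq : shaAn W = (q : ℂ)) (s : ℕ) (hs : (s : ℤ) ≤ padicValRat 3 q)
    {N : ℕ} [NeZero N] (D : ModularParametrizationData W N) (hc : ¬ (3 : ℤ) ∣ D.maninConstant)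
    (hper : ∃ u : ℚ, ‖(u : ℚ_[3])‖ = 1 ∧ W.realPeriodRat = u * plusPeriod D.f)
    (hGe : X4.KimTamagawaDefectGeAt W 3 D.f)
    (ℓ : ℕ) [Fact ℓ.Prime] (hℓ : Kato.IsKolyvaginPrime W 3 (padicValNat 3 W.tamagawaProduct + s + 1) ℓ)
    (hcyc : Nat.card {P : ((WeierstrassCurve.integralModelInt W).map
        (Int.castRingHom (ZMod ℓ))).toAffine.Point // 3 • P = 0} ≤ 3)
    (ψ : (ℓ' : ℕ) → (ZMod ℓ')ˣ →* Multiplicative (ZMod (3 ^ (padicValNat 3 W.tamagawaProduct + s + 1))))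
    (hψ : Function.Surjective (ψ ℓ))
    (hδ : kuriharaNumber D.f (3 ^ (padicValNat 3 W.tamagawaProduct + s + 1)) ℓ ψ ≠ 0) :
    MissingPPartAt W 3 ↔ MissingLowerBoundAt W 3 := by
  have hr1 : W.analyticRank ≤ 1 := by rw [hr]
  have hL : W.entireLFunction 1 = 0 := by
    by_contra hne
    have h0 := (W.analyticRank_eq_zero_iff_holds (hmod W)).mpr hne
    omega
  exact missingPPartAt_iff_missingLowerBoundAt_of_partial_of_tamagawaDefectGe_of_cert W 3
    (kimRankOnePartialAt_three_of_classX4 W h3 hX) hsurj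
    (towerSurj_three_of_surj_of_jWitness_or_nine W hsurj hcert) hL hr (hGZK W hr1).2 D
    (by exact_mod_cast hc) hper hGe hq s hs ℓ hℓ hcyc ψ hψ hδ

/-- **O7 ∩ X4@3, SHA row: `BSD(E,3) ↔ MissingLowerBoundAt W 3`** under the hypotheses of
`X4RankOne.missingPPartAt_three_iff_lower_…`. Per pair; nothing booked.
[cite: Kim2022StructureSelmer, Thm. 1.9 (6), Conj. 1.10 (PDF p. 8)] [cite: Miller2011LMS, §1 and Def. 1.1] -/
theorem X4RankOne.bsdp_three_iff_lower_of_partial_of_tamagawaDefectGe_of_cert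
    (h3 : X4SharpThreeKimRankOnePartial) (hGZK : rank_eq_analyticRank_of_analyticRank_le_one)
    (hmod : hasEntireLFunction_rat) (hX : ClassX4 W 3) (hsurj : Surj W 3)
    (hcert : (∃ q : ℕ, q.Prime ∧ q ≠ 3 ∧ padicValRat q W.j < 0 ∧ ¬ (3 : ℤ) ∣ padicValRat q W.j) ∨
      W.HasSurjectiveModNGaloisRep 9)
    (hr : W.analyticRank = 1) {q : ℚ} (hq : shaAn W = (q : ℂ)) (s : ℕ) (hs : (s : ℤ) ≤ padicValRat 3 q)
    {N : ℕ} [NeZero N] (D : ModularParametrizationData W N) (hc : ¬ (3 : ℤ) ∣ D.maninConstant)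
    (hper : ∃ u : ℚ, ‖(u : ℚ_[3])‖ = 1 ∧ W.realPeriodRat = u * plusPeriod D.f)
    (hGe : X4.KimTamagawaDefectGeAt W 3 D.f)
    (ℓ : ℕ) [Fact ℓ.Prime] (hℓ : Kato.IsKolyvaginPrime W 3 (padicValNat 3 W.tamagawaProduct + s + 1) ℓ)
    (hcyc : Nat.card {P : ((WeierstrassCurve.integralModelInt W).map
        (Int.castRingHom (ZMod ℓ))).toAffine.Point // 3 • P = 0} ≤ 3)
    (ψ : (ℓ' : ℕ) → (ZMod ℓ')ˣ →* Multiplicative (ZMod (3 ^ (padicValNat 3 W.tamagawaProduct + s + 1))))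
    (hψ : Function.Surjective (ψ ℓ))
    (hδ : kuriharaNumber D.f (3 ^ (padicValNat 3 W.tamagawaProduct + s + 1)) ℓ ψ ≠ 0) :
    BSDp W 3 ↔ MissingLowerBoundAt W 3 :=
  bsdp_iff_missingLowerBoundAt_of_partial_of_tamagawaDefectGe_of_cert W 3
    (kimRankOnePartialAt_three_of_classX4 W h3 hX) hGZK hmod hsurj
    (towerSurj_three_of_surj_of_jWitness_or_nine W hsurj hcert) hr D (by exact_mod_cast hc) hper hGe hq
    s hs ℓ hℓ hcyc ψ hψ hδ

/-- **The same with an OPTIMAL datum** (period binder discharged by `X4.periodTransfer_of_optimal`;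
`hopt` and `3 ∤ c_D` explicit — referee 1 ACK-1 T-a2r1 proviso (2)). Per pair; nothing booked.
[cite: Kim2022StructureSelmer, Thm. 1.9 (6), Conj. 1.10 (PDF p. 8)] [cite: CremonaAlgorithms1997, §2.8 (p. 26)]
[cite: Miller2011LMS, Def. 1.1] -/
theorem X4RankOne.bsdp_three_iff_lower_of_partial_of_tamagawaDefectGe_of_cert_of_optimal
    (h3 : X4SharpThreeKimRankOnePartial) (hGZK : rank_eq_analyticRank_of_analyticRank_le_one)
    (hmod : hasEntireLFunction_rat) (hX : ClassX4 W 3) (hsurj : Surj W 3)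
    (hcert : (∃ q : ℕ, q.Prime ∧ q ≠ 3 ∧ padicValRat q W.j < 0 ∧ ¬ (3 : ℤ) ∣ padicValRat q W.j) ∨
      W.HasSurjectiveModNGaloisRep 9)
    (hr : W.analyticRank = 1) {q : ℚ} (hq : shaAn W = (q : ℂ)) (s : ℕ) (hs : (s : ℤ) ≤ padicValRat 3 q)
    {N : ℕ} [NeZero N] (D : ModularParametrizationData W N)
    (hopt : ∀ z ∈ D.L.lattice, ∃ w ∈ periodLattice D.f, z = D.c * w)
    (hc : ¬ (3 : ℤ) ∣ D.maninConstant) (hGe : X4.KimTamagawaDefectGeAt W 3 D.f)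
    (ℓ : ℕ) [Fact ℓ.Prime] (hℓ : Kato.IsKolyvaginPrime W 3 (padicValNat 3 W.tamagawaProduct + s + 1) ℓ)
    (hcyc : Nat.card {P : ((WeierstrassCurve.integralModelInt W).map
        (Int.castRingHom (ZMod ℓ))).toAffine.Point // 3 • P = 0} ≤ 3)
    (ψ : (ℓ' : ℕ) → (ZMod ℓ')ˣ →* Multiplicative (ZMod (3 ^ (padicValNat 3 W.tamagawaProduct + s + 1))))
    (hψ : Function.Surjective (ψ ℓ))
    (hδ : kuriharaNumber D.f (3 ^ (padicValNat 3 W.tamagawaProduct + s + 1)) ℓ ψ ≠ 0) :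
    BSDp W 3 ↔ MissingLowerBoundAt W 3 :=
  X4RankOne.bsdp_three_iff_lower_of_partial_of_tamagawaDefectGe_of_cert W h3 hGZK hmod hX hsurj hcert hr
    hq s hs D hc (X4.periodTransfer_of_optimal 3 D hopt (by exact_mod_cast hc)) hGe ℓ hℓ hcyc ψ hψ hδ

/-! ## §3 Composition with the LOWER strand at `3` (T-O7, p01): the (G-ord)@3 SHA rows -/

/-- **X4♯(G-ord)@3 ∧ `r_an = 1`, SHA row: `BSD(E,3)` from {`∂`-clause@3, Conj. 1.10 `≥`,
`CycLowerBoundAt`@3} + ONE certificate.** Inputs, all explicit: `h3 : X4SharpThreeKimRankOnePartial`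
(OUR conjecture / [K25] announced), `hGe : X4.KimTamagawaDefectGeAt W 3 D.f` (Kim Conj. 1.10 `≥`),
Delbourgo 2002 (A)+(B) at `3` (`hDel3` = p16's `Delbourgo2002.mainTheorem_three`, PUBLISHED), the
typed Eisenstein half `CycLowerBoundAt W 3 Dh` with the Schneider rider for every (B)-datum (`hlow`,
team n1011's T = 0 input, via p01's `ClassX4Gord.missingLowerBoundAt_three_rankLeOne_of_cycLowerBound`),
GZK, modularity; row binders `ClassX4Gord W 3`, `¬ CM`, non-anomalous over the (G)-field, surj(3),
tower certificate, `#Ш_an = q`, a certificate at level `ord₃ ∏c + s + 1` with `s ≤ ord₃ q`. Per pair;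
NOT a class theorem; O7 / N10 marks unchanged; nothing booked.
[cite: Kim2022StructureSelmer, Thm. 1.9 (6), Conj. 1.10 (PDF p. 8)] [cite: Delbourgo2002, Theorem (A), (B) (p. 40), Hypothesis (p. 39)]
[cite: Miller2011LMS, Def. 1.1] -/
theorem ClassX4Gord.bsdp_three_rankOne_of_partial_of_cert_of_cycLowerBound
    (h3 : X4SharpThreeKimRankOnePartial) (hDel3 : Delbourgo2002.mainTheorem_three)
    (hGZK : rank_eq_analyticRank_of_analyticRank_le_one) (hmod : hasEntireLFunction_rat)
    (hX : ClassX4Gord W 3) (hcm : ¬ W.HasCM) (hna : ReductionNonAnomalous W 3)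
    (hlow : ∀ Dh : PAdicHeightData W 3, LeadingTermClauses W 3 Dh →
      SchneiderConjecture Dh ∧ CycLowerBoundAt W 3 Dh)
    (hsurj : Surj W 3)
    (hcert : (∃ q : ℕ, q.Prime ∧ q ≠ 3 ∧ padicValRat q W.j < 0 ∧ ¬ (3 : ℤ) ∣ padicValRat q W.j) ∨
      W.HasSurjectiveModNGaloisRep 9)
    (hr : W.analyticRank = 1) {q : ℚ} (hq : shaAn W = (q : ℂ)) (s : ℕ) (hs : (s : ℤ) ≤ padicValRat 3 q)
    {N : ℕ} [NeZero N] (D : ModularParametrizationData W N) (hc : ¬ (3 : ℤ) ∣ D.maninConstant)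
    (hper : ∃ u : ℚ, ‖(u : ℚ_[3])‖ = 1 ∧ W.realPeriodRat = u * plusPeriod D.f)
    (hGe : X4.KimTamagawaDefectGeAt W 3 D.f)
    (ℓ : ℕ) [Fact ℓ.Prime] (hℓ : Kato.IsKolyvaginPrime W 3 (padicValNat 3 W.tamagawaProduct + s + 1) ℓ)
    (hcyc : Nat.card {P : ((WeierstrassCurve.integralModelInt W).map
        (Int.castRingHom (ZMod ℓ))).toAffine.Point // 3 • P = 0} ≤ 3)
    (ψ : (ℓ' : ℕ) → (ZMod ℓ')ˣ →* Multiplicative (ZMod (3 ^ (padicValNat 3 W.tamagawaProduct + s + 1))))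
    (hψ : Function.Surjective (ψ ℓ))
    (hδ : kuriharaNumber D.f (3 ^ (padicValNat 3 W.tamagawaProduct + s + 1)) ℓ ψ ≠ 0) : BSDp W 3 :=
  (X4RankOne.bsdp_three_iff_lower_of_partial_of_tamagawaDefectGe_of_cert W h3 hGZK hmod hX.1 hsurj hcert
    hr hq s hs D hc hper hGe ℓ hℓ hcyc ψ hψ hδ).mpr
    (hX.missingLowerBoundAt_three_rankLeOne_of_cycLowerBound hDel3 hGZK hcm (by rw [hr]) hna hlow)

end Three

end Summit.BirchSwinnertonDyer.Rank1Residual.Additive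

/-! ## §3 (continued): the (M)@3 SHA rows (namespace of `ClassX4M`) -/

namespace Summit.BirchSwinnertonDyer.Rank1Residual.AdditivePotMult

open Summit.BirchSwinnertonDyer.Rank1Residual.Additive

variable (W : WeierstrassCurve ℚ) [W.IsElliptic] [W.IsGloballyMinimal]

/-- **X4(M)@3 ∧ `r_an = 1`, SHA row: `BSD(E,3)` from {`∂`-clause@3, Conj. 1.10 `≥`, `CycLowerBoundAt`@3}
+ ONE certificate.** As `ClassX4Gord.bsdp_three_rankOne_of_partial_of_cert_of_cycLowerBound`, on the
potentially multiplicative cell: Delbourgo 2002 (A)+(B) for (M) at every odd `p` (`hDelM` =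
`Delbourgo2002.mainTheorem_potMult`, PUBLISHED; `ℓ_3(E) = 1` on (M)), LOWER half via p01's
`ClassX4M.missingLowerBoundAt_rankLeOne_of_cycLowerBound`. Per pair; NOT a class theorem; nothing booked.
[cite: Kim2022StructureSelmer, Thm. 1.9 (6), Conj. 1.10 (PDF p. 8)] [cite: Delbourgo2002, Theorem (A), (B) (p. 40), Hypothesis (p. 39)]
[cite: Miller2011LMS, Def. 1.1] -/
theorem ClassX4M.bsdp_three_rankOne_of_partial_of_cert_of_cycLowerBound
    (h3 : X4SharpThreeKimRankOnePartial) (hDelM : Delbourgo2002.mainTheorem_potMult)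
    (hGZK : rank_eq_analyticRank_of_analyticRank_le_one) (hmod : hasEntireLFunction_rat)
    (hX : ClassX4M W 3)
    (hlow : ∀ Dh : PAdicHeightData W 3, LeadingTermClauses W 3 Dh →
      SchneiderConjecture Dh ∧ CycLowerBoundAt W 3 Dh)
    (hsurj : Surj W 3)
    (hcert : (∃ q : ℕ, q.Prime ∧ q ≠ 3 ∧ padicValRat q W.j < 0 ∧ ¬ (3 : ℤ) ∣ padicValRat q W.j) ∨
      W.HasSurjectiveModNGaloisRep 9)
    (hr : W.analyticRank = 1) {q : ℚ} (hq : shaAn W = (q : ℂ)) (s : ℕ) (hs : (s : ℤ) ≤ padicValRat 3 q)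
    {N : ℕ} [NeZero N] (D : ModularParametrizationData W N) (hc : ¬ (3 : ℤ) ∣ D.maninConstant)
    (hper : ∃ u : ℚ, ‖(u : ℚ_[3])‖ = 1 ∧ W.realPeriodRat = u * plusPeriod D.f)
    (hGe : X4.KimTamagawaDefectGeAt W 3 D.f)
    (ℓ : ℕ) [Fact ℓ.Prime] (hℓ : Kato.IsKolyvaginPrime W 3 (padicValNat 3 W.tamagawaProduct + s + 1) ℓ)
    (hcyc : Nat.card {P : ((WeierstrassCurve.integralModelInt W).map
        (Int.castRingHom (ZMod ℓ))).toAffine.Point // 3 • P = 0} ≤ 3)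
    (ψ : (ℓ' : ℕ) → (ZMod ℓ')ˣ →* Multiplicative (ZMod (3 ^ (padicValNat 3 W.tamagawaProduct + s + 1))))
    (hψ : Function.Surjective (ψ ℓ))
    (hδ : kuriharaNumber D.f (3 ^ (padicValNat 3 W.tamagawaProduct + s + 1)) ℓ ψ ≠ 0) : BSDp W 3 :=
  (X4RankOne.bsdp_three_iff_lower_of_partial_of_tamagawaDefectGe_of_cert W h3 hGZK hmod hX.classX4 hsurj
    hcert hr hq s hs D hc hper hGe ℓ hℓ hcyc ψ hψ hδ).mpr
    (hX.missingLowerBoundAt_rankLeOne_of_cycLowerBound hDelM hGZK (by rw [hr]) hlow)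

end Summit.BirchSwinnertonDyer.Rank1Residual.AdditivePotMult

end
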